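import Mathlib
import Summits.Ventures.PercRepro2.Defs
import Summits.Ventures.PercRepro2.Independence
import Summits.Ventures.PercRepro2.Harris
import Summits.Ventures.PercRepro2.Graph
import Summits.Ventures.PercRepro2.PartitionThree

/-!
# Lemma (P1) relativised to an increasing event (blind cell PercRepro2, mine-a g20;
MINE-A.md §67, lemma (★P1))

For finite bond percolation (`IsProbVec p`), three vertices `a b c` and ANY increasing event `W`
(`IsUpperSet W`), the Harris chain of `PartitionThree.lean` goes through unchanged with `{a ↔ b}`
replaced by `W ∩ {a ↔ b}`:

`P(W, a↔b, a↔c) · P(a↮b, a↮c) ≥ P(W, a↔b) · P(b↔c, a↮b, a↮c)`   (`partitionThree_chain_upper`),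

in partition notation `P(W ∩ abc) · P(a|b|c) ≥ P(W ∩ ab|c) · P(bc|a)` (`partitionThree_lattice_upper`).
Reading: the signed measure `σ(·) := P(· ∩ abc)·P(a|b|c) − P(· ∩ ab|c)·P(bc|a)` — whose total mass is
the (P1) slack — is nonnegative on every increasing event.  With `W = Ω` it is `partitionThree_lattice`.
(The lattice proof only uses that `W ∩ {a ↔ b}` is increasing and the two law-of-total-probability
identities; nothing about (ZC) — which asks for `σ(W) ≥ P(W)·σ(Ω)` on cluster up-sets — is claimed.)
One seat (mine-a g20).
-/

namespace Summit.Ventures.PercRepro2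

section PartitionThreeUpper

variable {V : Type*} {E : Type*} [Fintype E] [DecidableEq E] {R : Type*} [CommRing R]
  [PartialOrder R] [IsStrictOrderedRing R]

omit [Fintype E] [DecidableEq E] in
/-- On `W ∩ {a ↔ b}` the event `{b ↔ c}` forces `{a ↔ c}`. -/
lemma inter_connEvent_inter_subset_trans (W : Set (Config E)) (ends : E → Sym2 V) (a b c : V) :
    W ∩ connEvent ends a b ∩ connEvent ends b c ⊆ W ∩ connEvent ends a b ∩ connEvent ends a c :=
  fun _ h => ⟨h.1, conn_trans h.1.2 h.2⟩

/-- **The Harris chain for three vertices, relativised to an increasing event `W`** (lemma (★P1)):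
`P(W, a↔b, a↔c) · P(a↮b, a↮c) ≥ P(W, a↔b) · P(b↔c, a↮b, a↮c)`. -/
theorem partitionThree_chain_upper {p : E → R} (hp : IsProbVec p) (ends : E → Sym2 V) (a b c : V)
    {W : Set (Config E)} (hW : IsUpperSet W) :
    prob p (W ∩ connEvent ends a b) *
        prob p (((connEvent ends a b)ᶜ ∩ (connEvent ends a c)ᶜ) ∩ connEvent ends b c) ≤
      prob p (W ∩ connEvent ends a b ∩ connEvent ends a c) *
        prob p ((connEvent ends a b)ᶜ ∩ (connEvent ends a c)ᶜ) := by
  set D := (connEvent ends a b)ᶜ ∩ (connEvent ends a c)ᶜ with hD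
  have hWab : IsUpperSet (W ∩ connEvent ends a b) := hW.inter (isUpperSet_connEvent ends a b)
  have h1 : prob p (W ∩ connEvent ends a b ∩ connEvent ends b c) ≤
      prob p (W ∩ connEvent ends a b ∩ connEvent ends a c) :=
    prob_mono hp (inter_connEvent_inter_subset_trans W ends a b c)
  have h2 : prob p (W ∩ connEvent ends a b) * prob p (connEvent ends b c) ≤
      prob p (W ∩ connEvent ends a b ∩ connEvent ends b c) :=
    prob_mul_prob_le_prob_inter hp hWab (isUpperSet_connEvent ends b c)
  have h3 : prob p (D ∩ connEvent ends b c) ≤ prob p D * prob p (connEvent ends b c) :=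
    prob_inter_le_prob_mul_prob_of_isLowerSet hp (isLowerSet_not_conn_two ends a b c)
      (isUpperSet_connEvent ends b c)
  have hab : 0 ≤ prob p (W ∩ connEvent ends a b) := prob_nonneg hp _
  have hDn : 0 ≤ prob p D := prob_nonneg hp _
  calc prob p (W ∩ connEvent ends a b) * prob p (D ∩ connEvent ends b c)
      ≤ prob p (W ∩ connEvent ends a b) * (prob p D * prob p (connEvent ends b c)) :=
        mul_le_mul_of_nonneg_left h3 hab
    _ = prob p D * (prob p (W ∩ connEvent ends a b) * prob p (connEvent ends b c)) := by ring
    _ ≤ prob p D * prob p (W ∩ connEvent ends a b ∩ connEvent ends b c) :=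
        mul_le_mul_of_nonneg_left h2 hDn
    _ ≤ prob p D * prob p (W ∩ connEvent ends a b ∩ connEvent ends a c) :=
        mul_le_mul_of_nonneg_left h1 hDn
    _ = prob p (W ∩ connEvent ends a b ∩ connEvent ends a c) * prob p D := by ring

/-- `P(W ∩ ab|c) = P(W, a↔b) − P(W, a↔b, a↔c)`. -/
lemma prob_inter_partABc {p : E → R} (W : Set (Config E)) (ends : E → Sym2 V) (a b c : V) :
    prob p (W ∩ partABc ends a b c) =
      prob p (W ∩ connEvent ends a b) - prob p (W ∩ connEvent ends a b ∩ connEvent ends a c) := by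
  have h := prob_inter_add_prob_inter_compl p (W ∩ connEvent ends a b) (connEvent ends a c)
  have hset : W ∩ partABc ends a b c = W ∩ connEvent ends a b ∩ (connEvent ends a c)ᶜ := by
    unfold partABc; exact (Set.inter_assoc _ _ _).symm
  rw [hset]
  linear_combination h

omit [Fintype E] [DecidableEq E] in
/-- `W ∩ abc = W ∩ ab ∩ ac` as events. -/
lemma inter_partAll_eq (W : Set (Config E)) (ends : E → Sym2 V) (a b c : V) :
    W ∩ partAll ends a b c = W ∩ connEvent ends a b ∩ connEvent ends a c := by
  rw [partAll_eq, Set.inter_assoc]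

/-- **(★P1) — the (P1) lattice inequality relativised to an increasing event**:
`P(W ∩ abc) · P(a|b|c) ≥ P(W ∩ ab|c) · P(bc|a)` for every increasing `W`; `W = Ω` is
`partitionThree_lattice`. -/
theorem partitionThree_lattice_upper {p : E → R} (hp : IsProbVec p) (ends : E → Sym2 V) (a b c : V)
    {W : Set (Config E)} (hW : IsUpperSet W) :
    prob p (W ∩ partABc ends a b c) * prob p (partBCa ends a b c) ≤
      prob p (W ∩ partAll ends a b c) * prob p (partApart ends a b c) := by
  have hchain := partitionThree_chain_upper hp ends a b c hW
  rw [← partBCa_eq] at hchain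
  rw [inter_partAll_eq, prob_partApart, prob_inter_partABc]
  set x := prob p (W ∩ connEvent ends a b) with hx
  set y := prob p (W ∩ connEvent ends a b ∩ connEvent ends a c) with hy
  set z := prob p (partBCa ends a b c) with hz
  set w := prob p ((connEvent ends a b)ᶜ ∩ (connEvent ends a c)ᶜ) with hw
  calc (x - y) * z = x * z - y * z := by ring
    _ ≤ y * w - y * z := sub_le_sub_right hchain _
    _ = y * (w - z) := by ring

end PartitionThreeUpper

end Summit.Ventures.PercRepro2
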